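import Summits.ValiantsHypothesis.ValiantsHypothesis.Theses.IntegralGCT
import Summits.ValiantsHypothesis.ValiantsHypothesis.Theorems.IntegralGCTNoIntegralObstructionBarrierStatus

/-!
# `IntegralGCT.IntegralPrinciple` (item `stmt-ValiantsHypothesis-0980`) — the integral obstruction principle

Route `IntegralGCT` of `ValiantsHypothesis`, support item `IntegralPrinciple` (monotonicity of the
integral lattices under degeneration), stated against the route decl BY NAME.

If `g ∈ Δ[f]` (orbit closure over `ℂ`, any finite variable type `σ`), then `I(GL · f) ≤ I(GL · g)`
(`orbitVanishingIdeal_le_of_mem_orbitClosure`), so the canonical restriction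
`orbitCoordRestrict m h : ℂ[Δ[f]] →ₐ ℂ[Δ[g]]` is the identity on representatives; restricted to the
degree-`d` pieces it is a `GL σ ℂ`-intertwining map `ℂ[Δ[f]]_d → ℂ[Δ[g]]_d` sending the class of an
integer form `F` to the class of the same `F`, hence carrying the lattice
`Λ(f, d) = {classes of integer homogeneous degree-d forms}` ONTO `Λ(g, d)` — the
Bürgisser–Landsberg–Manivel–Weyman surjection template (BLMW11 §2) read over `ℤ`.

This computation is already in the tree, for general forms `f, g`, as
`IntegralGCTNoIntegralObstructionBarrier.exists_latticeOnto_intertwiner_of_mem_orbitClosure`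
(file `Theorems/IntegralGCTNoIntegralObstructionBarrierStatus.lean`, landed for the sibling item
`stmt-ValiantsHypothesis-0982`); this file does not redo it but links it to the route decl
`IntegralPrinciple`, whose statement it matches binder for binder.
-/

-- `Summit.ValiantsHypothesis.ValiantsHypothesis.…` duplicates a component by design (D-0017).
set_option linter.dupNamespace false

namespace Summit.ValiantsHypothesis.ValiantsHypothesis.Theorems.IntegralGCTIntegralPrinciple

/-- **`IntegralGCT.IntegralPrinciple` holds** (item `stmt-ValiantsHypothesis-0980`, the integral
obstruction principle / monotonicity): if `g ∈ Δ[f]` over `ℂ` then for every `m, d` there is a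
`GL`-intertwining map `ℂ[Δ[f]]_d → ℂ[Δ[g]]_d` (the degree-`d` restriction of functions) carrying
the integral lattice of `f` onto the integral lattice of `g`; contrapositively, an integral
obstruction in some degree proves `g ∉ Δ[f]`. By
`IntegralGCTNoIntegralObstructionBarrier.exists_latticeOnto_intertwiner_of_mem_orbitClosure`.
[Bürgisser–Landsberg–Manivel–Weyman 2011, §2 (surjection template), read over `ℤ`;
Mulmuley–Sohoni 2008] [folklore] -/
theorem integralPrinciple_proof :
    Summit.ValiantsHypothesis.ValiantsHypothesis.Theses.IntegralGCT.IntegralPrinciple := by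
  intro σ _ _ f g m d h
  exact IntegralGCTNoIntegralObstructionBarrier.exists_latticeOnto_intertwiner_of_mem_orbitClosure
    f g m d h

end Summit.ValiantsHypothesis.ValiantsHypothesis.Theorems.IntegralGCTIntegralPrinciple
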